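import Mathlib
import Summits.Ventures.PercRepro2.EightTypedDomCore
import Summits.Ventures.PercRepro2.EightTypedDomTransfer
import Summits.Ventures.PercRepro2.SortedPairs8
import Summits.Ventures.PercRepro2.MonoTPos
import Summits.Ventures.PercRepro2.TypedResidualDegree
import Summits.Ventures.PercRepro2.TypedResidualCruxMarks
import Summits.Ventures.PercRepro2.TypedResidualSplit

/-!
# Eight typed edges, XII.D: the DOMAIN-RESTRICTED reduced class (blind cell PercRepro2, night-3 g10, 2026-08-26)

g9's domain-restricted bridge (`SevenTypedDomBridge.lean`) one rung up: the label-level guards of the reduced class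
(`labD8_marks`, `labD8_loop` / `labD8_par` / `labD8_root`, `edeg8_eq`, `labD8_deg`), the transfers of the domain
hypotheses (`labD8_markdeg`, `typedConfig_eight`, `exists_bad_of_not_mild8`), and **`typedCount_oct_K3_nonneg_dom`** /
**`typedCount_nonneg_of_dom_card_eight`**: row 2′TRI on every reduced instance with eight typed edges whose marks
`a₁, a₂, o, b` carry typed edges, whose roots are connected in the typed graph and which is not mild (`z ≡ false`,
marks distinct up to `b = a₃` / `o = b`), modulo the finite statement `allOkC8 okQ8Dom = true` — the sorted member of
the orbit (`exists_sorted8`) and the sorted core.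
-/

namespace Summit.Ventures.PercRepro2

open UnionCluster

namespace CovForm

namespace TwoTyped

open OneTyped TypedRed

section Bridge8D

open Classical TypedRed

variable {V : Type*} {E : Type*} [DecidableEq V] [Fintype E] [DecidableEq E] {R : Type*} [Field R]
  [LinearOrder R] [IsStrictOrderedRing R]
variable (ends : E → Sym2 V) (o a₁ a₂ a₃ b : V) (ps : Fin 8 → V × V)

omit [DecidableEq V] [Fintype E] [DecidableEq E] in
/-- In the all-closed configuration, labels agree exactly when the points coincide. -/
lemma labD8_eq_iff (p q : ℕ) :
    labD8 ends o a₁ a₂ a₃ b ps p = labD8 ends o a₁ a₂ a₃ b ps q ↔ pt o a₁ a₂ a₃ b (xsOf8 ps) p = pt o a₁ a₂ a₃ b (xsOf8 ps) q := by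
  unfold labD8
  rw [lab_eq_iff, conn_allClosed_iff]

omit [DecidableEq V] [Fintype E] [DecidableEq E] in
/-- `a₁` carries the label `0`. -/
lemma labD8_zero : labD8 ends o a₁ a₂ a₃ b ps 0 = 0 := lab_zero ends o a₁ a₂ a₃ b (xsOf8 ps) _

omit [DecidableEq V] [Fintype E] [DecidableEq E] in
/-- A label is at most its index. -/
lemma labD8_le (i : ℕ) : labD8 ends o a₁ a₂ a₃ b ps i ≤ i := lab_le ends o a₁ a₂ a₃ b (xsOf8 ps) _ i

omit [DecidableEq V] [Fintype E] [DecidableEq E] in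
/-- Labels are idempotent. -/
lemma labD8_idem (i : ℕ) : labD8 ends o a₁ a₂ a₃ b ps (labD8 ends o a₁ a₂ a₃ b ps i) = labD8 ends o a₁ a₂ a₃ b ps i :=
  lab_idem ends o a₁ a₂ a₃ b (xsOf8 ps) _ i

omit [DecidableEq V] [Fintype E] [DecidableEq E] in
/-- **The labels of the marks**: `a₂ ↦ 1`, `o ↦ 2`, `b ↦ 3` or `2` (`o = b`), `a₃ ↦ 4` or `3`
(`a₃ = b`). -/
lemma labD8_marks (hm : MarksDistinct o a₁ a₂ a₃ b) :
    labD8 ends o a₁ a₂ a₃ b ps 1 = 1 ∧ labD8 ends o a₁ a₂ a₃ b ps 2 = 2 ∧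
      ((labD8 ends o a₁ a₂ a₃ b ps 3 = 3 ∧ labD8 ends o a₁ a₂ a₃ b ps 4 = 4) ∨ (labD8 ends o a₁ a₂ a₃ b ps 3 = 3 ∧ labD8 ends o a₁ a₂ a₃ b ps 4 = 3) ∨ (labD8 ends o a₁ a₂ a₃ b ps 3 = 2 ∧ labD8 ends o a₁ a₂ a₃ b ps 4 = 4)) := by
  obtain ⟨⟨h12, h31, h32, ho1, ho2, hb1, hb2⟩, ho3⟩ := hm
  have e := labD8_eq_iff ends o a₁ a₂ a₃ b ps
  have z := labD8_zero ends o a₁ a₂ a₃ b ps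
  have l1 := labD8_le ends o a₁ a₂ a₃ b ps 1
  have l2 := labD8_le ends o a₁ a₂ a₃ b ps 2
  have l3 := labD8_le ends o a₁ a₂ a₃ b ps 3
  have l4 := labD8_le ends o a₁ a₂ a₃ b ps 4
  have i4 := labD8_idem ends o a₁ a₂ a₃ b ps 4
  have p0 : pt o a₁ a₂ a₃ b (xsOf8 ps) 0 = a₁ := rfl
  have p1 : pt o a₁ a₂ a₃ b (xsOf8 ps) 1 = a₂ := rfl
  have p2 : pt o a₁ a₂ a₃ b (xsOf8 ps) 2 = o := rfl
  have p3 : pt o a₁ a₂ a₃ b (xsOf8 ps) 3 = b := rfl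
  have p4 : pt o a₁ a₂ a₃ b (xsOf8 ps) 4 = a₃ := rfl
  have f1 : labD8 ends o a₁ a₂ a₃ b ps 1 = 1 := by
    by_contra h
    have h0 : labD8 ends o a₁ a₂ a₃ b ps 1 = labD8 ends o a₁ a₂ a₃ b ps 0 := by omega
    rw [e, p1, p0] at h0
    exact h12 h0.symm
  have f2 : labD8 ends o a₁ a₂ a₃ b ps 2 = 2 := by
    by_contra h
    rcases (show labD8 ends o a₁ a₂ a₃ b ps 2 = 0 ∨ labD8 ends o a₁ a₂ a₃ b ps 2 = 1 by omega) with h0 | h0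
    · have := (e 2 0).mp (by rw [h0, z]); rw [p2, p0] at this; exact ho1 this
    · have := (e 2 1).mp (by rw [h0, f1]); rw [p2, p1] at this; exact ho2 this
  have f3 : labD8 ends o a₁ a₂ a₃ b ps 3 = 3 ∨ labD8 ends o a₁ a₂ a₃ b ps 3 = 2 := by
    by_contra h
    rcases (show labD8 ends o a₁ a₂ a₃ b ps 3 = 0 ∨ labD8 ends o a₁ a₂ a₃ b ps 3 = 1 by omega) with h0 | h0
    · have := (e 3 0).mp (by rw [h0, z]); rw [p3, p0] at this; exact hb1 this
    · have := (e 3 1).mp (by rw [h0, f1]); rw [p3, p1] at this; exact hb2 this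
  have f4 : labD8 ends o a₁ a₂ a₃ b ps 4 = 4 ∨ labD8 ends o a₁ a₂ a₃ b ps 4 = 3 := by
    by_contra h
    rcases (show labD8 ends o a₁ a₂ a₃ b ps 4 = 0 ∨ labD8 ends o a₁ a₂ a₃ b ps 4 = 1 ∨ labD8 ends o a₁ a₂ a₃ b ps 4 = 2 by omega) with h0 | h0 | h0
    · have := (e 4 0).mp (by rw [h0, z]); rw [p4, p0] at this; exact h31 this
    · have := (e 4 1).mp (by rw [h0, f1]); rw [p4, p1] at this; exact h32 this
    · have := (e 4 2).mp (by rw [h0, f2]); rw [p4, p2] at this; exact ho3 this.symm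
  refine ⟨f1, f2, ?_⟩
  rcases f3 with h3 | h3 <;> rcases f4 with h4 | h4
  · exact Or.inl ⟨h3, h4⟩
  · exact Or.inr (Or.inl ⟨h3, h4⟩)
  · exact Or.inr (Or.inr ⟨h3, h4⟩)
  · exfalso
    rw [h4, h3] at i4
    omega

omit [DecidableEq V] [Fintype E] [DecidableEq E] in
/-- No typed loop: the two ends of a typed edge carry different labels. -/
lemma labD8_loop {F : Finset E} (hred : Reduced ends o a₁ a₂ a₃ b F) {e : E} (he : e ∈ F)
    {x y : V} (hends : ends e = s(x, y)) {u w : ℕ} (hu : pt o a₁ a₂ a₃ b (xsOf8 ps) u = x)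
    (hw : pt o a₁ a₂ a₃ b (xsOf8 ps) w = y) :
    labD8 ends o a₁ a₂ a₃ b ps u ≠ labD8 ends o a₁ a₂ a₃ b ps w := by
  intro h
  rw [labD8_eq_iff, hu, hw] at h
  exact hred.no_loop e he (by rw [hends, h]; exact Sym2.mk_isDiag_iff.mpr rfl)

omit [DecidableEq V] [Fintype E] [DecidableEq E] in
/-- No parallel typed pair: two typed edges do not carry the same ordered label pair. -/
lemma labD8_par {F : Finset E} (hred : Reduced ends o a₁ a₂ a₃ b F) {e e' : E} (he : e ∈ F)
    (he' : e' ∈ F) (hne : e ≠ e') {x y x' y' : V} (hends : ends e = s(x, y))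
    (hends' : ends e' = s(x', y')) {u w u' w' : ℕ} (hu : pt o a₁ a₂ a₃ b (xsOf8 ps) u = x)
    (hw : pt o a₁ a₂ a₃ b (xsOf8 ps) w = y) (hu' : pt o a₁ a₂ a₃ b (xsOf8 ps) u' = x') (hw' : pt o a₁ a₂ a₃ b (xsOf8 ps) w' = y') :
    labD8 ends o a₁ a₂ a₃ b ps u = labD8 ends o a₁ a₂ a₃ b ps u' → labD8 ends o a₁ a₂ a₃ b ps w ≠ labD8 ends o a₁ a₂ a₃ b ps w' := by
  intro h1 h2
  rw [labD8_eq_iff, hu, hu'] at h1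
  rw [labD8_eq_iff, hw, hw'] at h2
  exact hred.no_parallel e he e' he' hne (by rw [hends, hends', h1, h2])

omit [DecidableEq V] [Fintype E] [DecidableEq E] in
/-- No typed root pair: no typed edge carries the labels `(0, 1)`. -/
lemma labD8_root (hm : MarksDistinct o a₁ a₂ a₃ b) {F : Finset E} (hred : Reduced ends o a₁ a₂ a₃ b F)
    {e : E} (he : e ∈ F) {x y : V} (hends : ends e = s(x, y)) {u w : ℕ}
    (hu : pt o a₁ a₂ a₃ b (xsOf8 ps) u = x) (hw : pt o a₁ a₂ a₃ b (xsOf8 ps) w = y) :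
    ¬ (labD8 ends o a₁ a₂ a₃ b ps u = 0 ∧ labD8 ends o a₁ a₂ a₃ b ps w = 1) := by
  rintro ⟨h0, h1⟩
  have e0 : labD8 ends o a₁ a₂ a₃ b ps u = labD8 ends o a₁ a₂ a₃ b ps 0 := by
    rw [h0, labD8_zero]
  have e1 : labD8 ends o a₁ a₂ a₃ b ps w = labD8 ends o a₁ a₂ a₃ b ps 1 := by
    rw [h1, (labD8_marks ends o a₁ a₂ a₃ b ps hm).1]
  rw [labD8_eq_iff, hu] at e0
  rw [labD8_eq_iff, hw] at e1
  exact hred.no_root_pair e he (by rw [hends, e0, e1]; rfl)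

omit [Fintype E] in
/-- The typed degree over eight distinct typed edges, as eight indicators. -/
lemma typedDeg_eight (e1 e2 e3 e4 e5 e6 e7 e8 : E) (h12 : e1 ≠ e2) (h13 : e1 ≠ e3) (h14 : e1 ≠ e4) (h15 : e1 ≠ e5) (h16 : e1 ≠ e6) (h17 : e1 ≠ e7) (h18 : e1 ≠ e8) (h23 : e2 ≠ e3) (h24 : e2 ≠ e4) (h25 : e2 ≠ e5) (h26 : e2 ≠ e6) (h27 : e2 ≠ e7) (h28 : e2 ≠ e8) (h34 : e3 ≠ e4) (h35 : e3 ≠ e5) (h36 : e3 ≠ e6) (h37 : e3 ≠ e7) (h38 : e3 ≠ e8) (h45 : e4 ≠ e5) (h46 : e4 ≠ e6) (h47 : e4 ≠ e7) (h48 : e4 ≠ e8) (h56 : e5 ≠ e6) (h57 : e5 ≠ e7) (h58 : e5 ≠ e8) (h67 : e6 ≠ e7) (h68 : e6 ≠ e8) (h78 : e7 ≠ e8) (v : V) :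
    typedDeg ends {e1, e2, e3, e4, e5, e6, e7, e8} v =
      (if v ∈ ends e1 then 1 else 0) + (if v ∈ ends e2 then 1 else 0) + (if v ∈ ends e3 then 1 else 0) +
        (if v ∈ ends e4 then 1 else 0) + (if v ∈ ends e5 then 1 else 0) + (if v ∈ ends e6 then 1 else 0) +
        (if v ∈ ends e7 then 1 else 0) + (if v ∈ ends e8 then 1 else 0) := by
  unfold typedDeg
  rw [Finset.card_filter, Finset.sum_insert (by simp [h12, h13, h14, h15, h16, h17, h18]), Finset.sum_insert (by simp [h23, h24, h25, h26, h27, h28]), Finset.sum_insert (by simp [h34, h35, h36, h37, h38]), Finset.sum_insert (by simp [h45, h46, h47, h48]), Finset.sum_insert (by simp [h56, h57, h58]), Finset.sum_insert (by simp [h67, h68]), Finset.sum_insert (by simp [h78]), Finset.sum_singleton]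
  ring

omit [Fintype E] in
/-- **The edge-degree of a label is the typed degree of its vertex.** -/
lemma edeg8_eq (e1 e2 e3 e4 e5 e6 e7 e8 : E) (h12 : e1 ≠ e2) (h13 : e1 ≠ e3) (h14 : e1 ≠ e4) (h15 : e1 ≠ e5) (h16 : e1 ≠ e6) (h17 : e1 ≠ e7) (h18 : e1 ≠ e8) (h23 : e2 ≠ e3) (h24 : e2 ≠ e4) (h25 : e2 ≠ e5) (h26 : e2 ≠ e6) (h27 : e2 ≠ e7) (h28 : e2 ≠ e8) (h34 : e3 ≠ e4) (h35 : e3 ≠ e5) (h36 : e3 ≠ e6) (h37 : e3 ≠ e7) (h38 : e3 ≠ e8) (h45 : e4 ≠ e5) (h46 : e4 ≠ e6) (h47 : e4 ≠ e7) (h48 : e4 ≠ e8) (h56 : e5 ≠ e6) (h57 : e5 ≠ e7) (h58 : e5 ≠ e8) (h67 : e6 ≠ e7) (h68 : e6 ≠ e8) (h78 : e7 ≠ e8) (hends1 : ends e1 = s((ps 0).1, (ps 0).2)) (hends2 : ends e2 = s((ps 1).1, (ps 1).2)) (hends3 : ends e3 = s((ps 2).1, (ps 2).2)) (hends4 : ends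 e4 = s((ps 3).1, (ps 3).2)) (hends5 : ends e5 = s((ps 4).1, (ps 4).2)) (hends6 : ends e6 = s((ps 5).1, (ps 5).2)) (hends7 : ends e7 = s((ps 6).1, (ps 6).2)) (hends8 : ends e8 = s((ps 7).1, (ps 7).2)) (p : ℕ) :
    edeg8 (labD8 ends o a₁ a₂ a₃ b ps p) (labD8 ends o a₁ a₂ a₃ b ps 5) (labD8 ends o a₁ a₂ a₃ b ps 6) (labD8 ends o a₁ a₂ a₃ b ps 7) (labD8 ends o a₁ a₂ a₃ b ps 8) (labD8 ends o a₁ a₂ a₃ b ps 9) (labD8 ends o a₁ a₂ a₃ b ps 10) (labD8 ends o a₁ a₂ a₃ b ps 11) (labD8 ends o a₁ a₂ a₃ b ps 12) (labD8 ends o a₁ a₂ a₃ b ps 13) (labD8 ends o a₁ a₂ a₃ b ps 14) (labD8 ends o a₁ a₂ a₃ b ps 15) (labD8 ends o a₁ a₂ a₃ b ps 16) (labD8 ends o a₁ a₂ a₃ b ps 17) (labD8 ends o a₁ a₂ a₃ b ps 18) (labD8 ends o a₁ a₂ a₃ b ps 19) (labD8 ends o a₁ a₂ a₃ b ps 20)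 = typedDeg ends {e1, e2, e3, e4, e5, e6, e7, e8} (pt o a₁ a₂ a₃ b (xsOf8 ps) p) := by
  rw [typedDeg_eight ends e1 e2 e3 e4 e5 e6 e7 e8 h12 h13 h14 h15 h16 h17 h18 h23 h24 h25 h26 h27 h28 h34 h35 h36 h37 h38 h45 h46 h47 h48 h56 h57 h58 h67 h68 h78]
  unfold edeg8
  simp only [hends1, hends2, hends3, hends4, hends5, hends6, hends7, hends8, Sym2.mem_iff, ← pt_xsOf8_5 o a₁ a₂ a₃ b ps, ← pt_xsOf8_6 o a₁ a₂ a₃ b ps, ← pt_xsOf8_7 o a₁ a₂ a₃ b ps, ← pt_xsOf8_8 o a₁ a₂ a₃ b ps, ← pt_xsOf8_9 o a₁ a₂ a₃ b ps, ← pt_xsOf8_10 o a₁ a₂ a₃ b ps, ← pt_xsOf8_11 o a₁ a₂ a₃ b ps, ← pt_xsOf8_12 o a₁ a₂ a₃ b ps, ← pt_xsOf8_13 o a₁ a₂ a₃ b ps, ← pt_xsOf8_14 o a₁ a₂ a₃ b ps, ← pt_xsOf8_15 o a₁ a₂ a₃ b ps, ← pt_xsOf8_16 o a₁ a₂ a₃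 b ps, ← pt_xsOf8_17 o a₁ a₂ a₃ b ps, ← pt_xsOf8_18 o a₁ a₂ a₃ b ps, ← pt_xsOf8_19 o a₁ a₂ a₃ b ps, ← pt_xsOf8_20 o a₁ a₂ a₃ b ps,
    ← labD8_eq_iff ends o a₁ a₂ a₃ b ps]
  simp only [eq_comm]

omit [Fintype E] [DecidableEq E] in
/-- A nonzero typed degree gives a typed edge at the vertex. -/
lemma exists_edge_of_typedDeg_ne_zero8 {F : Finset E} {v : V} (h : typedDeg ends F v ≠ 0) :
    ∃ f ∈ F, v ∈ ends f := by
  unfold typedDeg at h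
  obtain ⟨f, hf⟩ := Finset.card_ne_zero.mp h
  rw [Finset.mem_filter] at hf
  exact ⟨f, hf.1, hf.2⟩

omit [Fintype E] in
/-- **The leaf guard holds on a reduced instance**: unmarked labels have typed degree `≥ 3`; `o`
(when `o ≠ b`) and `b` (when distinct from `o`, `a₃`) are not typed leaves. -/
lemma labD8_deg (hm : MarksDistinct o a₁ a₂ a₃ b) (e1 e2 e3 e4 e5 e6 e7 e8 : E)
    (hred : Reduced ends o a₁ a₂ a₃ b {e1, e2, e3, e4, e5, e6, e7, e8}) (h12 : e1 ≠ e2) (h13 : e1 ≠ e3) (h14 : e1 ≠ e4) (h15 : e1 ≠ e5) (h16 : e1 ≠ e6) (h17 : e1 ≠ e7) (h18 : e1 ≠ e8) (h23 : e2 ≠ e3) (h24 : e2 ≠ e4) (h25 : e2 ≠ e5) (h26 : e2 ≠ e6) (h27 : e2 ≠ e7) (h28 : e2 ≠ e8) (h34 : e3 ≠ e4) (h35 : e3 ≠ e5) (h36 : e3 ≠ e6) (h37 : e3 ≠ e7) (h38 : e3 ≠ e8) (h45 : e4 ≠ e5) (h46 : e4 ≠ e6) (h47 : e4 ≠ e7)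 (h48 : e4 ≠ e8) (h56 : e5 ≠ e6) (h57 : e5 ≠ e7) (h58 : e5 ≠ e8) (h67 : e6 ≠ e7) (h68 : e6 ≠ e8) (h78 : e7 ≠ e8) (hends1 : ends e1 = s((ps 0).1, (ps 0).2)) (hends2 : ends e2 = s((ps 1).1, (ps 1).2)) (hends3 : ends e3 = s((ps 2).1, (ps 2).2)) (hends4 : ends e4 = s((ps 3).1, (ps 3).2)) (hends5 : ends e5 = s((ps 4).1, (ps 4).2)) (hends6 : ends e6 = s((ps 5).1, (ps 5).2)) (hends7 : ends e7 = s((ps 6).1, (ps 6).2)) (hends8 : ends e8 = s((ps 7).1, (ps 7).2)) :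
    degOK8 (labD8 ends o a₁ a₂ a₃ b ps 3) (labD8 ends o a₁ a₂ a₃ b ps 4) (labD8 ends o a₁ a₂ a₃ b ps 5) (labD8 ends o a₁ a₂ a₃ b ps 6) (labD8 ends o a₁ a₂ a₃ b ps 7) (labD8 ends o a₁ a₂ a₃ b ps 8) (labD8 ends o a₁ a₂ a₃ b ps 9) (labD8 ends o a₁ a₂ a₃ b ps 10) (labD8 ends o a₁ a₂ a₃ b ps 11) (labD8 ends o a₁ a₂ a₃ b ps 12) (labD8 ends o a₁ a₂ a₃ b ps 13) (labD8 ends o a₁ a₂ a₃ b ps 14) (labD8 ends o a₁ a₂ a₃ b ps 15) (labD8 ends o a₁ a₂ a₃ b ps 16) (labD8 ends o a₁ a₂ a₃ b ps 17) (labD8 ends o a₁ a₂ a₃ b ps 18) (labD8 ends o a₁ a₂ a₃ b ps 19) (labD8 ends o a₁ a₂ a₃ b ps 20) = true := by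
  have hdeg := edeg8_eq ends o a₁ a₂ a₃ b ps e1 e2 e3 e4 e5 e6 e7 e8 h12 h13 h14 h15 h16 h17 h18 h23 h24 h25 h26 h27 h28 h34 h35 h36 h37 h38 h45 h46 h47 h48 h56 h57 h58 h67 h68 h78 hends1 hends2 hends3 hends4 hends5 hends6 hends7 hends8
  have hmk := labD8_marks ends o a₁ a₂ a₃ b ps hm
  have hle := labD8_le ends o a₁ a₂ a₃ b ps
  have heq := labD8_eq_iff ends o a₁ a₂ a₃ b ps
  obtain ⟨⟨h12', h31, h32, ho1, ho2, hb1, hb2⟩, ho3⟩ := hm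
  have hmem : ∀ p, 5 ≤ p → p ≤ 20 → ∃ f ∈ ({e1, e2, e3, e4, e5, e6, e7, e8} : Finset E), pt o a₁ a₂ a₃ b (xsOf8 ps) p ∈ ends f := by
    intro p hp5 hp
    interval_cases p
    · exact ⟨e1, by simp, by rw [hends1]; exact Sym2.mem_mk_left _ _⟩
    · exact ⟨e1, by simp, by rw [hends1]; exact Sym2.mem_mk_right _ _⟩
    · exact ⟨e2, by simp, by rw [hends2]; exact Sym2.mem_mk_left _ _⟩
    · exact ⟨e2, by simp, by rw [hends2]; exact Sym2.mem_mk_right _ _⟩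
    · exact ⟨e3, by simp, by rw [hends3]; exact Sym2.mem_mk_left _ _⟩
    · exact ⟨e3, by simp, by rw [hends3]; exact Sym2.mem_mk_right _ _⟩
    · exact ⟨e4, by simp, by rw [hends4]; exact Sym2.mem_mk_left _ _⟩
    · exact ⟨e4, by simp, by rw [hends4]; exact Sym2.mem_mk_right _ _⟩
    · exact ⟨e5, by simp, by rw [hends5]; exact Sym2.mem_mk_left _ _⟩
    · exact ⟨e5, by simp, by rw [hends5]; exact Sym2.mem_mk_right _ _⟩
    · exact ⟨e6, by simp, by rw [hends6]; exact Sym2.mem_mk_left _ _⟩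
    · exact ⟨e6, by simp, by rw [hends6]; exact Sym2.mem_mk_right _ _⟩
    · exact ⟨e7, by simp, by rw [hends7]; exact Sym2.mem_mk_left _ _⟩
    · exact ⟨e7, by simp, by rw [hends7]; exact Sym2.mem_mk_right _ _⟩
    · exact ⟨e8, by simp, by rw [hends8]; exact Sym2.mem_mk_left _ _⟩
    · exact ⟨e8, by simp, by rw [hends8]; exact Sym2.mem_mk_right _ _⟩
  have hunm : ∀ p, 5 ≤ p → p ≤ 20 → labD8 ends o a₁ a₂ a₃ b ps p < 5 ∨ 3 ≤ edeg8 (labD8 ends o a₁ a₂ a₃ b ps p) (labD8 ends o a₁ a₂ a₃ b ps 5) (labD8 ends o a₁ a₂ a₃ b ps 6) (labD8 ends o a₁ a₂ a₃ b ps 7) (labD8 ends o a₁ a₂ a₃ b ps 8) (labD8 ends o a₁ a₂ a₃ b ps 9) (labD8 ends o a₁ a₂ a₃ b ps 10) (labD8 ends o a₁ a₂ a₃ b ps 11) (labD8 ends o a₁ a₂ a₃ b ps 12) (labD8 ends o a₁ a₂ a₃ b ps 13) (labD8 ends o a₁ a₂ a₃ b ps 14) (labD8 ends o a₁ a₂ a₃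 b ps 15) (labD8 ends o a₁ a₂ a₃ b ps 16) (labD8 ends o a₁ a₂ a₃ b ps 17) (labD8 ends o a₁ a₂ a₃ b ps 18) (labD8 ends o a₁ a₂ a₃ b ps 19) (labD8 ends o a₁ a₂ a₃ b ps 20) := by
    intro p hp5 hp
    by_cases hlt : labD8 ends o a₁ a₂ a₃ b ps p < 5
    · exact Or.inl hlt
    right
    rw [hdeg p]
    obtain ⟨f, hf, hpf⟩ := hmem p hp5 hp
    have hne : ∀ q, q < 5 → pt o a₁ a₂ a₃ b (xsOf8 ps) p ≠ pt o a₁ a₂ a₃ b (xsOf8 ps) q := by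
      intro q hq h
      have := (heq p q).mpr h
      have := hle q
      omega
    exact hred.typedDeg_unmarked (hne 2 (by omega)) (hne 0 (by omega)) (hne 1 (by omega))
      (hne 4 (by omega)) (hne 3 (by omega)) hf hpf
  have ho : labD8 ends o a₁ a₂ a₃ b ps 3 = 2 ∨ edeg8 2 (labD8 ends o a₁ a₂ a₃ b ps 5) (labD8 ends o a₁ a₂ a₃ b ps 6) (labD8 ends o a₁ a₂ a₃ b ps 7) (labD8 ends o a₁ a₂ a₃ b ps 8) (labD8 ends o a₁ a₂ a₃ b ps 9) (labD8 ends o a₁ a₂ a₃ b ps 10) (labD8 ends o a₁ a₂ a₃ b ps 11) (labD8 ends o a₁ a₂ a₃ b ps 12) (labD8 ends o a₁ a₂ a₃ b ps 13) (labD8 ends o a₁ a₂ a₃ b ps 14) (labD8 ends o a₁ a₂ a₃ b ps 15) (labD8 ends o a₁ a₂ a₃ b ps 16) (labD8 ends o a₁ a₂ a₃ b ps 17) (labD8 ends o a₁ a₂ a₃ b ps 18) (labD8 ends o a₁ a₂ a₃ b ps 19) (labD8 ends o a₁ a₂ a₃ b ps 20) ≠ 1 := by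
    by_cases h3 : labD8 ends o a₁ a₂ a₃ b ps 3 = 2
    · exact Or.inl h3
    right
    have hob : o ≠ b := by
      intro h
      apply h3
      rw [← hmk.2.1]
      exact (heq 3 2).mpr h.symm
    rw [← hmk.2.1, hdeg 2]
    have p2 : pt o a₁ a₂ a₃ b (xsOf8 ps) 2 = o := rfl
    rw [p2]
    intro h1
    obtain ⟨f, hf, hof⟩ := exists_edge_of_typedDeg_ne_zero8 ends (by rw [h1]; exact one_ne_zero)
    have := hred.typedDeg_o ho1 ho2 ho3 hob hf hof
    omega
  have hb : (labD8 ends o a₁ a₂ a₃ b ps 3 ≠ 3 ∨ labD8 ends o a₁ a₂ a₃ b ps 4 ≠ 4) ∨ edeg8 3 (labD8 ends o a₁ a₂ a₃ b ps 5) (labD8 ends o a₁ a₂ a₃ b ps 6) (labD8 ends o a₁ a₂ a₃ b ps 7) (labD8 ends o a₁ a₂ a₃ b ps 8) (labD8 ends o a₁ a₂ a₃ b ps 9) (labD8 ends o a₁ a₂ a₃ b ps 10) (labD8 ends o a₁ a₂ a₃ b ps 11) (labD8 ends o a₁ a₂ a₃ b ps 12) (labD8 ends o a₁ a₂ a₃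 b ps 13) (labD8 ends o a₁ a₂ a₃ b ps 14) (labD8 ends o a₁ a₂ a₃ b ps 15) (labD8 ends o a₁ a₂ a₃ b ps 16) (labD8 ends o a₁ a₂ a₃ b ps 17) (labD8 ends o a₁ a₂ a₃ b ps 18) (labD8 ends o a₁ a₂ a₃ b ps 19) (labD8 ends o a₁ a₂ a₃ b ps 20) ≠ 1 := by
    by_cases h34 : labD8 ends o a₁ a₂ a₃ b ps 3 = 3 ∧ labD8 ends o a₁ a₂ a₃ b ps 4 = 4
    swap
    · left
      by_contra hc
      exact h34 ⟨not_not.mp (fun h => hc (Or.inl h)), not_not.mp (fun h => hc (Or.inr h))⟩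
    right
    have hbo : b ≠ o := by
      intro h
      have := (heq 3 2).mpr h
      omega
    have hb3 : b ≠ a₃ := by
      intro h
      have := (heq 3 4).mpr h
      omega
    rw [← h34.1, hdeg 3]
    have p3 : pt o a₁ a₂ a₃ b (xsOf8 ps) 3 = b := rfl
    rw [p3]
    intro h1
    obtain ⟨f, hf, hbf⟩ := exists_edge_of_typedDeg_ne_zero8 ends (by rw [h1]; exact one_ne_zero)
    have := hred.typedDeg_b hbo hb1 hb2 hb3 hf hbf
    omega
  unfold degOK8
  simp only [Bool.and_eq_true, decide_eq_true_eq]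
  exact ⟨⟨⟨hunm 5 (by omega) (by omega),
    hunm 6 (by omega) (by omega),
    hunm 7 (by omega) (by omega),
    hunm 8 (by omega) (by omega),
    hunm 9 (by omega) (by omega),
    hunm 10 (by omega) (by omega),
    hunm 11 (by omega) (by omega),
    hunm 12 (by omega) (by omega),
    hunm 13 (by omega) (by omega),
    hunm 14 (by omega) (by omega),
    hunm 15 (by omega) (by omega),
    hunm 16 (by omega) (by omega),
    hunm 17 (by omega) (by omega),
    hunm 18 (by omega) (by omega),
    hunm 19 (by omega) (by omega),
    hunm 20 (by omega) (by omega)⟩, ho⟩, hb⟩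

omit [Fintype E] in
/-- **The mark-degree guard holds when the marks `a₁, a₂, o, b` carry typed edges.** -/
lemma labD8_markdeg (hm : MarksDistinct o a₁ a₂ a₃ b) (e1 e2 e3 e4 e5 e6 e7 e8 : E) (h12 : e1 ≠ e2) (h13 : e1 ≠ e3) (h14 : e1 ≠ e4) (h15 : e1 ≠ e5) (h16 : e1 ≠ e6) (h17 : e1 ≠ e7) (h18 : e1 ≠ e8) (h23 : e2 ≠ e3) (h24 : e2 ≠ e4) (h25 : e2 ≠ e5) (h26 : e2 ≠ e6) (h27 : e2 ≠ e7) (h28 : e2 ≠ e8) (h34 : e3 ≠ e4) (h35 : e3 ≠ e5) (h36 : e3 ≠ e6) (h37 : e3 ≠ e7) (h38 : e3 ≠ e8) (h45 : e4 ≠ e5) (h46 : e4 ≠ e6) (h47 : e4 ≠ e7) (h48 : e4 ≠ e8) (h56 : e5 ≠ e6) (h57 : e5 ≠ e7) (h58 : e5 ≠ e8) (h67 : e6 ≠ e7) (h68 : e6 ≠ e8) (h78 : e7 ≠ e8) (hends1 : ends e1 = s((ps 0).1, (ps 0).2)) (hends2 : ends e2 = s((ps 1).1, (ps 1).2)) (hends3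 : ends e3 = s((ps 2).1, (ps 2).2)) (hends4 : ends e4 = s((ps 3).1, (ps 3).2)) (hends5 : ends e5 = s((ps 4).1, (ps 4).2)) (hends6 : ends e6 = s((ps 5).1, (ps 5).2)) (hends7 : ends e7 = s((ps 6).1, (ps 6).2)) (hends8 : ends e8 = s((ps 7).1, (ps 7).2))
    (hd1 : ∃ f ∈ ({e1, e2, e3, e4, e5, e6, e7, e8} : Finset E), a₁ ∈ ends f) (hd2 : ∃ f ∈ ({e1, e2, e3, e4, e5, e6, e7, e8} : Finset E), a₂ ∈ ends f)
    (hdo : ∃ f ∈ ({e1, e2, e3, e4, e5, e6, e7, e8} : Finset E), o ∈ ends f) (hdb : ∃ f ∈ ({e1, e2, e3, e4, e5, e6, e7, e8} : Finset E), b ∈ ends f) :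
    markDegOK8 (labD8 ends o a₁ a₂ a₃ b ps 3) (labD8 ends o a₁ a₂ a₃ b ps 5) (labD8 ends o a₁ a₂ a₃ b ps 6) (labD8 ends o a₁ a₂ a₃ b ps 7) (labD8 ends o a₁ a₂ a₃ b ps 8) (labD8 ends o a₁ a₂ a₃ b ps 9) (labD8 ends o a₁ a₂ a₃ b ps 10) (labD8 ends o a₁ a₂ a₃ b ps 11) (labD8 ends o a₁ a₂ a₃ b ps 12) (labD8 ends o a₁ a₂ a₃ b ps 13) (labD8 ends o a₁ a₂ a₃ b ps 14) (labD8 ends o a₁ a₂ a₃ b ps 15) (labD8 ends o a₁ a₂ a₃ b ps 16) (labD8 ends o a₁ a₂ a₃ b ps 17) (labD8 ends o a₁ a₂ a₃ b ps 18) (labD8 ends o a₁ a₂ a₃ b ps 19) (labD8 ends o a₁ a₂ a₃ b ps 20) = true := by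
  have hdeg := edeg8_eq ends o a₁ a₂ a₃ b ps e1 e2 e3 e4 e5 e6 e7 e8 h12 h13 h14 h15 h16 h17 h18 h23 h24 h25 h26 h27 h28 h34 h35 h36 h37 h38 h45 h46 h47 h48 h56 h57 h58 h67 h68 h78 hends1 hends2 hends3 hends4 hends5 hends6 hends7 hends8
  have hmk := labD8_marks ends o a₁ a₂ a₃ b ps hm
  have hpos : ∀ v : V, (∃ f ∈ ({e1, e2, e3, e4, e5, e6, e7, e8} : Finset E), v ∈ ends f) → 1 ≤ typedDeg ends {e1, e2, e3, e4, e5, e6, e7, e8} v := by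
    rintro v ⟨f, hf, hv⟩
    exact Finset.card_pos.mpr ⟨f, Finset.mem_filter.mpr ⟨hf, hv⟩⟩
  have h0 := hdeg 0
  rw [labD8_zero] at h0
  have h1 := hdeg 1
  rw [hmk.1] at h1
  have h2 := hdeg 2
  rw [hmk.2.1] at h2
  have h3 := hdeg 3
  unfold markDegOK8
  simp only [Bool.and_eq_true, decide_eq_true_eq]
  exact ⟨⟨⟨by rw [h0]; exact hpos _ hd1, by rw [h1]; exact hpos _ hd2⟩, by rw [h2]; exact hpos _ hdo⟩, by rw [h3]; exact hpos _ hdb⟩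

/-- **Eight typed edges of a reduced instance IN THE DOMAIN OF RECORD**, modulo the finite statement
`allOkC8 okQ8Dom = true`: the ends are re-ordered and re-oriented to the sorted member of their orbit
(`exists_sorted8`) and the sorted core applies. -/
theorem typedCount_oct_K3_nonneg_dom (hall : allOkC8 okQ8Dom = true) (hm : MarksDistinct o a₁ a₂ a₃ b)
    (e : Fin 8 → E) (hinj : Function.Injective e)
    (hred : Reduced ends o a₁ a₂ a₃ b (Finset.univ.image e)) (τ : E → ℕ)
    (hτ : ∀ i, τ (e i) = 1 ∨ τ (e i) = 2)
    (hcon : Conn ends (TypedRed.typedConfig (Finset.univ.image e)) a₁ a₂)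
    (hmild : ¬ RootBridge.MildInst ends o a₁ a₂ a₃ b (Finset.univ.image e) (fun _ => false))
    (hd1 : ∃ f ∈ Finset.univ.image e, a₁ ∈ ends f) (hd2 : ∃ f ∈ Finset.univ.image e, a₂ ∈ ends f)
    (hdo : ∃ f ∈ Finset.univ.image e, o ∈ ends f) (hdb : ∃ f ∈ Finset.univ.image e, b ∈ ends f) :
    0 ≤ typedCount (Finset.univ.image e) (fun _ => false) τ
      (K3 ends o a₁ a₂ a₃ b : Config E → Config E → Config E → R) := by
  have hex : ∀ i : Fin 8, ∃ p : V × V, ends (e i) = s(p.1, p.2) := fun i => by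
    obtain ⟨⟨u, w⟩, h⟩ := Quot.exists_rep (ends (e i))
    exact ⟨(u, w), h.symm⟩
  choose ps hps using hex
  obtain ⟨σ, fl, hsort⟩ := exists_sorted8 ends o a₁ a₂ a₃ b (fun _ => false) ps
  have hF : Finset.univ.image e = ({e (σ 0), e (σ 1), e (σ 2), e (σ 3), e (σ 4), e (σ 5), e (σ 6), e (σ 7)} : Finset E) := by
    rw [← Finset.image_univ_of_surjective σ.surjective, Finset.image_image]
    ext x
    simp only [Finset.mem_image, Finset.mem_univ, true_and, Finset.mem_insert, Finset.mem_singleton,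
      Function.comp]
    constructor
    · rintro ⟨i, rfl⟩
      fin_cases i <;> simp
    · rintro (rfl | rfl | rfl | rfl | rfl | rfl | rfl | rfl) <;> exact ⟨_, rfl⟩
  have hends' : ∀ i, ends (e (σ i)) = s((act8 σ fl ps i).1, (act8 σ fl ps i).2) := by
    intro i
    simp only [act8]
    split_ifs
    · rw [hps (σ i), Sym2.eq_swap]
    · exact hps (σ i)
  have hne : ∀ i j : Fin 8, i ≠ j → e (σ i) ≠ e (σ j) := fun i j hij h =>
    hij (σ.injective (hinj h))
  rw [hF] at hred hcon hmild hd1 hd2 hdo hdb ⊢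
  have hmem : ∀ i : Fin 8, e (σ i) ∈ ({e (σ 0), e (σ 1), e (σ 2), e (σ 3), e (σ 4), e (σ 5), e (σ 6), e (σ 7)} : Finset E) := by
    intro i
    fin_cases i <;> simp
  have hred' := hred
  refine typedCount_oct_core_dom ends o a₁ a₂ a₃ b hall (e (σ 0)) (e (σ 1)) (e (σ 2)) (e (σ 3)) (e (σ 4)) (e (σ 5)) (e (σ 6)) (e (σ 7))
    (hne 0 1 (by decide)) (hne 0 2 (by decide)) (hne 0 3 (by decide)) (hne 0 4 (by decide)) (hne 0 5 (by decide)) (hne 0 6 (by decide)) (hne 0 7 (by decide)) (hne 1 2 (by decide)) (hne 1 3 (by decide)) (hne 1 4 (by decide)) (hne 1 5 (by decide)) (hne 1 6 (by decide)) (hne 1 7 (by decide)) (hne 2 3 (by decide)) (hne 2 4 (by decide)) (hne 2 5 (by decide)) (hne 2 6 (by decide)) (hne 2 7 (by decide)) (hne 3 4 (by decide)) (hne 3 5 (by decide)) (hne 3 6 (by decide)) (hne 3 7 (by decide)) (hne 4 5 (by decide)) (hne 4 6 (by decide)) (hne 4 7 (by decide)) (hne 5 6 (by decide)) (hne 5 7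 (by decide)) (hne 6 7 (by decide)) τ ?_ (act8 σ fl ps)
    (hends' 0) (hends' 1) (hends' 2) (hends' 3) (hends' 4) (hends' 5) (hends' 6) (hends' 7) hsort
    (labD8_marks ends o a₁ a₂ a₃ b (act8 σ fl ps) hm)
    (labD8_loop ends o a₁ a₂ a₃ b (act8 σ fl ps) hred' (hmem 0) (hends' 0) rfl rfl) (labD8_loop ends o a₁ a₂ a₃ b (act8 σ fl ps) hred' (hmem 1) (hends' 1) rfl rfl) (labD8_loop ends o a₁ a₂ a₃ b (act8 σ fl ps) hred' (hmem 2) (hends' 2) rfl rfl) (labD8_loop ends o a₁ a₂ a₃ b (act8 σ fl ps) hred' (hmem 3) (hends' 3) rfl rfl) (labD8_loop ends o a₁ a₂ a₃ b (act8 σ fl ps) hred' (hmem 4) (hends' 4) rfl rfl) (labD8_loop ends o a₁ a₂ a₃ b (act8 σ fl ps) hred' (hmem 5) (hends' 5) rfl rfl) (labD8_loop ends o a₁ a₂ a₃ b (act8 σ fl ps) hred' (hmem 6) (hends' 6) rfl rfl) (labD8_loop ends o a₁ a₂ a₃ b (act8 σ fl ps) hred' (hmem 7) (hends' 7) rfl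 rfl)
    (labD8_par ends o a₁ a₂ a₃ b (act8 σ fl ps) hred' (hmem 0) (hmem 1) (hne 0 1 (by decide)) (hends' 0) (hends' 1) rfl rfl rfl rfl) (labD8_par ends o a₁ a₂ a₃ b (act8 σ fl ps) hred' (hmem 1) (hmem 2) (hne 1 2 (by decide)) (hends' 1) (hends' 2) rfl rfl rfl rfl) (labD8_par ends o a₁ a₂ a₃ b (act8 σ fl ps) hred' (hmem 2) (hmem 3) (hne 2 3 (by decide)) (hends' 2) (hends' 3) rfl rfl rfl rfl) (labD8_par ends o a₁ a₂ a₃ b (act8 σ fl ps) hred' (hmem 3) (hmem 4) (hne 3 4 (by decide)) (hends' 3) (hends' 4) rfl rfl rfl rfl) (labD8_par ends o a₁ a₂ a₃ b (act8 σ fl ps) hred' (hmem 4) (hmem 5) (hne 4 5 (by decide)) (hends' 4) (hends' 5) rfl rfl rfl rfl) (labD8_par ends o a₁ a₂ a₃ b (act8 σ fl ps) hred' (hmem 5) (hmem 6) (hne 5 6 (by decide)) (hends' 5) (hends' 6) rfl rfl rfl rfl) (labD8_par ends o a₁ a₂ a₃ b (act8 σ fl ps) hred' (hmem 6) (hmem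 7) (hne 6 7 (by decide)) (hends' 6) (hends' 7) rfl rfl rfl rfl)
    (labD8_root ends o a₁ a₂ a₃ b (act8 σ fl ps) hm hred' (hmem 0) (hends' 0) rfl rfl) (labD8_root ends o a₁ a₂ a₃ b (act8 σ fl ps) hm hred' (hmem 1) (hends' 1) rfl rfl) (labD8_root ends o a₁ a₂ a₃ b (act8 σ fl ps) hm hred' (hmem 2) (hends' 2) rfl rfl) (labD8_root ends o a₁ a₂ a₃ b (act8 σ fl ps) hm hred' (hmem 3) (hends' 3) rfl rfl) (labD8_root ends o a₁ a₂ a₃ b (act8 σ fl ps) hm hred' (hmem 4) (hends' 4) rfl rfl) (labD8_root ends o a₁ a₂ a₃ b (act8 σ fl ps) hm hred' (hmem 5) (hends' 5) rfl rfl) (labD8_root ends o a₁ a₂ a₃ b (act8 σ fl ps) hm hred' (hmem 6) (hends' 6) rfl rfl) (labD8_root ends o a₁ a₂ a₃ b (act8 σ fl ps) hm hred' (hmem 7) (hends' 7) rfl rfl)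
    (labD8_deg ends o a₁ a₂ a₃ b (act8 σ fl ps) hm (e (σ 0)) (e (σ 1)) (e (σ 2)) (e (σ 3)) (e (σ 4)) (e (σ 5)) (e (σ 6)) (e (σ 7)) hred'
      (hne 0 1 (by decide)) (hne 0 2 (by decide)) (hne 0 3 (by decide)) (hne 0 4 (by decide)) (hne 0 5 (by decide)) (hne 0 6 (by decide)) (hne 0 7 (by decide)) (hne 1 2 (by decide)) (hne 1 3 (by decide)) (hne 1 4 (by decide)) (hne 1 5 (by decide)) (hne 1 6 (by decide)) (hne 1 7 (by decide)) (hne 2 3 (by decide)) (hne 2 4 (by decide)) (hne 2 5 (by decide)) (hne 2 6 (by decide)) (hne 2 7 (by decide)) (hne 3 4 (by decide)) (hne 3 5 (by decide)) (hne 3 6 (by decide)) (hne 3 7 (by decide)) (hne 4 5 (by decide)) (hne 4 6 (by decide)) (hne 4 7 (by decide)) (hne 5 6 (by decide)) (hne 5 7 (by decide)) (hne 6 7 (by decide)) (hends' 0) (hends' 1) (hends' 2) (hends' 3) (hends' 4) (hends' 5) (hends' 6) (hends' 7))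
    (labD8_markdeg ends o a₁ a₂ a₃ b (act8 σ fl ps) hm (e (σ 0)) (e (σ 1)) (e (σ 2)) (e (σ 3)) (e (σ 4)) (e (σ 5)) (e (σ 6)) (e (σ 7)) (hne 0 1 (by decide)) (hne 0 2 (by decide)) (hne 0 3 (by decide)) (hne 0 4 (by decide)) (hne 0 5 (by decide)) (hne 0 6 (by decide)) (hne 0 7 (by decide)) (hne 1 2 (by decide)) (hne 1 3 (by decide)) (hne 1 4 (by decide)) (hne 1 5 (by decide)) (hne 1 6 (by decide)) (hne 1 7 (by decide)) (hne 2 3 (by decide)) (hne 2 4 (by decide)) (hne 2 5 (by decide)) (hne 2 6 (by decide)) (hne 2 7 (by decide)) (hne 3 4 (by decide)) (hne 3 5 (by decide)) (hne 3 6 (by decide)) (hne 3 7 (by decide)) (hne 4 5 (by decide)) (hne 4 6 (by decide)) (hne 4 7 (by decide)) (hne 5 6 (by decide)) (hne 5 7 (by decide)) (hne 6 7 (by decide)) (hends' 0) (hends' 1) (hends' 2) (hends' 3) (hends' 4) (hends' 5) (hends' 6) (hends' 7) hd1 hd2 hdo hdb)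
    (by rw [← typedConfig_eight]; exact hcon)
    (exists_bad_of_not_mild8 ends o a₁ a₂ a₃ b (e (σ 0)) (e (σ 1)) (e (σ 2)) (e (σ 3)) (e (σ 4)) (e (σ 5)) (e (σ 6)) (e (σ 7)) (hne 0 1 (by decide)) (hne 0 2 (by decide)) (hne 0 3 (by decide)) (hne 0 4 (by decide)) (hne 0 5 (by decide)) (hne 0 6 (by decide)) (hne 0 7 (by decide)) (hne 1 2 (by decide)) (hne 1 3 (by decide)) (hne 1 4 (by decide)) (hne 1 5 (by decide)) (hne 1 6 (by decide)) (hne 1 7 (by decide)) (hne 2 3 (by decide)) (hne 2 4 (by decide)) (hne 2 5 (by decide)) (hne 2 6 (by decide)) (hne 2 7 (by decide)) (hne 3 4 (by decide)) (hne 3 5 (by decide)) (hne 3 6 (by decide)) (hne 3 7 (by decide)) (hne 4 5 (by decide)) (hne 4 6 (by decide)) (hne 4 7 (by decide)) (hne 5 6 (by decide)) (hne 5 7 (by decide)) (hne 6 7 (by decide)) hmild)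
  intro e' he'
  simp only [Finset.mem_insert, Finset.mem_singleton] at he'
  rcases he' with rfl | rfl | rfl | rfl | rfl | rfl | rfl | rfl <;> exact hτ _

/-- **ROW 2′TRI ON THE DOMAIN-RESTRICTED REDUCED CLASS WITH EIGHT TYPED EDGES**, modulo the finite statement:
(marks `a₁, a₂, o, b` of typed degree `≥ 1`, roots connected in the typed graph, not mild) every reduced instance
(`z ≡ false`, marks distinct up to `b = a₃` / `o = b`) with exactly eight typed edges has a nonnegative typed base. -/
theorem typedCount_nonneg_of_dom_card_eight (hall : allOkC8 okQ8Dom = true) (hm : MarksDistinct o a₁ a₂ a₃ b)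
    (F : Finset E) (hF : F.card = 8) (hred : Reduced ends o a₁ a₂ a₃ b F) (τ : E → ℕ)
    (hτ : ∀ e ∈ F, τ e = 1 ∨ τ e = 2)
    (hcon : Conn ends (TypedRed.typedConfig F) a₁ a₂)
    (hmild : ¬ RootBridge.MildInst ends o a₁ a₂ a₃ b F (fun _ => false))
    (hd1 : ∃ f ∈ F, a₁ ∈ ends f) (hd2 : ∃ f ∈ F, a₂ ∈ ends f) (hdo : ∃ f ∈ F, o ∈ ends f)
    (hdb : ∃ f ∈ F, b ∈ ends f) :
    0 ≤ typedCount F (fun _ => false) τ (K3 ends o a₁ a₂ a₃ b : Config E → Config E → Config E → R) := by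
  let eq : F ≃ Fin 8 := (Finset.equivFin F).trans (finCongr hF)
  let e : Fin 8 → E := fun i => (eq.symm i).1
  have hinj : Function.Injective e := fun i j h => eq.symm.injective (Subtype.ext h)
  have hFe : Finset.univ.image e = F := by
    ext x
    simp only [Finset.mem_image, Finset.mem_univ, true_and]
    constructor
    · rintro ⟨i, rfl⟩
      exact (eq.symm i).2
    · intro hx
      exact ⟨eq ⟨x, hx⟩, by simp [e]⟩
  rw [← hFe] at hred hcon hmild hd1 hd2 hdo hdb ⊢
  exact typedCount_oct_K3_nonneg_dom ends o a₁ a₂ a₃ b hall hm e hinj hred τ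
    (fun i => hτ (e i) (by rw [← hFe]; exact Finset.mem_image_of_mem e (Finset.mem_univ i))) hcon hmild hd1 hd2 hdo hdb

end Bridge8D

end TwoTyped

end CovForm

end Summit.Ventures.PercRepro2
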